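import Summits.FinalStateConjecture.FinalStateConjecture.Theorems.ZeroEnergyKerrOrBombSymplecticDualOfTheBombDefs2
import Summits.FinalStateConjecture.FinalStateConjecture.Theorems.ZeroEnergyKerrOrBombOneLockedExplosionDefs
import Summits.FinalStateConjecture.FinalStateConjecture.Theorems.ZeroEnergyKerrOrBombStationaryLimitReductionTimeEquivariantMaps
import Summits.FinalStateConjecture.FinalStateConjecture.Theorems.BartnikGapSettlingGapExhaustionFutureDirectedDichotomy
import Literature.Geometry.Lorentzian.StationaryBlackHoleUniquenessProofs
import Literature.Geometry.Lorentzian.KerrSchildCoord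
import Literature.Geometry.Lorentzian.KerrDataProofs
import Literature.Geometry.Lorentzian.KerrHyperboloidalLeaves
import Literature.Geometry.Lorentzian.TimeCones
import HarnessLib

/-!
# Route ZeroEnergyKerrOrBomb · crux `FinalStateFromKerrOrBomb` (stmt-FinalStateConjecture-17839), line
# `SketchIdeator1` — stub `stub_kerrIsometryResiduals`, conjunct F5: the Kerr identification is future-preserving

Helper file (`--supports stmt-FinalStateConjecture-17839`; registered helper `kerrIdentificationFuture`, the
F5 conjunct `Sig7.stub_kerrIdentificationFuture` of the registered stub `stub_kerrIsometryResiduals`, stated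
UNFOLDED over built modules).

**Statement.** Let `𝓑` be a stationary black hole, `A` an adapted chart and `Θ` a `T`-equivariant isometric
identification of the Kerr exterior with the d.o.c. part of `A` (`IsKerrChartedWith 𝓑 A M a c r₀ Θ`:
`Θ (x + s e₀) = Θ x + (c s) e₀` with `c > 0`, `A.bilin (Θ x) (dΘ v) (dΘ w) = g_{M,a}(x)(v, w)` on the exterior,
`Θ '' exterior = A⁻¹(doc)`). Then at every point `u` of the Kerr exterior the push-forward by `A ∘ Θ` of
Kerr's timelike field `V = Kerr.timeVector M a` is future-directed for `𝓑`.

**Proof** (O'Neill 1983, Ch. 5, Lemma 5.26 ff. and Lemma 5.32).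
* §1 Chain rule through the open submanifold `A.domain`: for any corestriction `φ : E4 → A.domain` of `Θ`
  on an open set `S` (`↑(φ x) = Θ x` on `S`), `d(A ∘ φ)_x v = dA_{φ x} (dΘ_x v)`, `A ∘ φ` is `C^∞` on `S`,
  and the chart components of `g` along `A ∘ φ` are `A.bilin (Θ x) (dΘ_x ·, dΘ_x ·)`
  (`AdaptedChart.bilin_eq`), hence `= g_{M,a}(x)` on the exterior by the isometry clause.
* §2 So `d(A ∘ φ)(V)` is timelike (`g_{M,a}(V, V) = −1 − 2H < 0`, `M > 0`), `d(A ∘ φ)_x` is injective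
  (`g_{M,a}(x)` is nondegenerate), and by the landed orientation dichotomy
  `stub_futureDirected_dichotomy` (a continuous nowhere-null time function on the CONNECTED exterior,
  `Kerr.isConnected_region_holds`) the vectors `d(A ∘ φ)_z (V z)` are either all future or all past.
* §3 They are future at one point: `M_ext ≠ ∅`, `M_ext ⊆ doc ⊆ range A` and the anchor give `u₁` in the
  exterior with `A (Θ u₁) ∈ M_ext`, where `T = dA(e₀)` is future timelike (`isStationary`); there
  `dΘ (e₀) = c e₀` (`fderiv_apply_basisVector_zero_of_contDiffOn`), so
  `g(dA e₀, dA dΘ V) = c⁻¹ g_{M,a}(e₀, V) = −c⁻¹ < 0` (`Kerr.bilin_timeVector`), and a causal vector in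
  the cone of a future timelike vector is future (`isFutureDirected_of_val_lt_zero`).

References: B. O'Neill, *Semi-Riemannian Geometry* (1983), Ch. 5, pp. 141–145; P. T. Chruściel,
J. L. Costa, arXiv:0806.0016, §2.2.
-/

set_option linter.dupNamespace false

-- instance search through the nested operator types `E4 →L[ℝ] E4 →L[ℝ] ℝ`
set_option maxSynthPendingDepth 3

noncomputable section

open scoped Manifold ContDiff Topology
open Set Filter Function

namespace Summit.FinalStateConjecture.FinalStateConjecture.Theorems.SymplecticDualOfTheBomb

open Literature.Geometry.Lorentzian Literature.Geometry.Manifold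
open Summit.FinalStateConjecture.FinalStateConjecture.Theorems.OneLockedExplosion

/-! ## §1 Chain rule through the adapted chart for a corestriction of `Θ` -/

section Comp

variable {𝓑 : StationaryAFBlackHole.{0}} (A : 𝓑.AdaptedChart) {S : Set E4} {Θ : E4 → E4}
  {φ : E4 → A.domain}

/-- **Chain rule through the open submanifold `A.domain`.** If `φ : E4 → A.domain` corestricts `Θ` on the
open set `S` (`↑(φ y) = Θ y` for `y ∈ S`) and `Θ` is differentiable at `x ∈ S`, then `A ∘ φ` has manifold
derivative `dA_{φ x} ∘ dΘ_x` at `x` (the corestriction has the derivative of `Θ`,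
`OpensChart.hasMFDerivAt_codRestrict`; Lee, Prop. 3.9). [folklore] -/
theorem hasMFDerivAt_adaptedChart_comp (hS : IsOpen S) (hφ : ∀ x ∈ S, (φ x : E4) = Θ x) {x : E4}
    (hx : x ∈ S) (hd : DifferentiableAt ℝ Θ x) :
    HasMFDerivAt 𝓘(ℝ, E4) (𝓡 4) (A.toFun ∘ φ) x
      ((mfderiv 𝓘(ℝ, E4) (𝓡 4) A.toFun (φ x)).comp (fderiv ℝ Θ x)) := by
  have h1 : HasMFDerivAt 𝓘(ℝ, E4) 𝓘(ℝ, E4) (Subtype.val ∘ φ) x (fderiv ℝ Θ x) :=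
    (hasMFDerivAt_iff_hasFDerivAt.2 hd.hasFDerivAt).congr_of_eventuallyEq
      (Filter.eventuallyEq_of_mem (hS.mem_nhds hx) fun y hy ↦ hφ y hy)
  have h2 : HasMFDerivAt 𝓘(ℝ, E4) 𝓘(ℝ, E4) φ x (fderiv ℝ Θ x) :=
    OpensChart.hasMFDerivAt_codRestrict (f := Subtype.val ∘ φ) (fun _ ↦ rfl) h1
  have h3 : HasMFDerivAt 𝓘(ℝ, E4) (𝓡 4) A.toFun (φ x) (mfderiv 𝓘(ℝ, E4) (𝓡 4) A.toFun (φ x)) :=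
    (A.contMDiff.mdifferentiableAt (by simp)).hasMFDerivAt
  exact h3.comp x h2

/-- Pointwise form of the chain rule: `d(A ∘ φ)_x v = dA_{φ x} (dΘ_x v)`. [folklore] -/
theorem mfderiv_adaptedChart_comp_apply (hS : IsOpen S) (hφ : ∀ x ∈ S, (φ x : E4) = Θ x) {x : E4}
    (hx : x ∈ S) (hd : DifferentiableAt ℝ Θ x) (v : E4) :
    mfderiv 𝓘(ℝ, E4) (𝓡 4) (A.toFun ∘ φ) x v =
      mfderiv 𝓘(ℝ, E4) (𝓡 4) A.toFun (φ x) (fderiv ℝ Θ x v) := by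
  rw [(hasMFDerivAt_adaptedChart_comp A hS hφ hx hd).mfderiv]
  rfl

/-- `A ∘ φ` is `C^∞` on `S` when `Θ` is (the corestriction of a `C^∞` map to an open submanifold is
`C^∞`, `ContMDiffAt.subtypeVal_comp_iff`, composed with the `C^∞` chart map). [folklore] -/
theorem contMDiffOn_adaptedChart_comp (hS : IsOpen S) (hφ : ∀ x ∈ S, (φ x : E4) = Θ x)
    (hΘ : ContDiffOn ℝ ∞ Θ S) : ContMDiffOn 𝓘(ℝ, E4) (𝓡 4) ∞ (A.toFun ∘ φ) S := by
  refine A.contMDiff.comp_contMDiffOn fun x hx ↦ ContMDiffAt.contMDiffWithinAt ?_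
  have h1 : ContMDiffAt 𝓘(ℝ, E4) 𝓘(ℝ, E4) ∞ (Subtype.val ∘ φ) x :=
    (contMDiffAt_iff_contDiffAt.2 (hΘ.contDiffAt (hS.mem_nhds hx))).congr_of_eventuallyEq
      (Filter.eventuallyEq_of_mem (hS.mem_nhds hx) fun y hy ↦ hφ y hy)
  exact (ContMDiffAt.subtypeVal_comp_iff A.domain φ x).1 h1

/-- **The chart components of `g` along `A ∘ φ` are those of `A.bilin` pulled back by `Θ`**:
`g(d(A ∘ φ) v, d(A ∘ φ) w) = A.bilin (Θ x) (dΘ v) (dΘ w)` (`A.bilin = A^* g`, field `bilin_eq`).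
[folklore] -/
theorem metricInCoords_adaptedChart_comp (hS : IsOpen S) (hφ : ∀ x ∈ S, (φ x : E4) = Θ x) {x : E4}
    (hx : x ∈ S) (hd : DifferentiableAt ℝ Θ x) (v w : E4) :
    𝓑.toSpacetime.metricInCoords (A.toFun ∘ φ) x v w =
      A.bilin (Θ x) (fderiv ℝ Θ x v) (fderiv ℝ Θ x w) := by
  rw [Spacetime.metricInCoords_apply, mfderiv_adaptedChart_comp_apply A hS hφ hx hd,
    mfderiv_adaptedChart_comp_apply A hS hφ hx hd, ← hφ x hx, A.bilin_eq (φ x)]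
  rfl

end Comp

/-! ## §2–3 The registered helper -/

/-- **Stub 1R-F5 `kerrIdentificationFuture` (conjunct F5 of `stub_kerrIsometryResiduals`, line
`SketchIdeator1` of crux stmt-FinalStateConjecture-17839; the statement `Sig7.stub_kerrIdentificationFuture`
unfolded).** For a `T`-equivariant isometric Kerr identification `Θ` of a hole (`IsKerrChartedWith`), the
push-forward by `A ∘ Θ` of Kerr's future timelike field `V_{M,a} = −g♯(dt*)` is future-directed for `𝓑` at
every point of the Kerr exterior. Proof: the pushed field is timelike (`g_{M,a}(V,V) < 0`, `Θ` isometric,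
`A.bilin = A^* g`), hence of one orientation on the connected exterior (`stub_futureDirected_dichotomy`); at a
point charted into `M_ext` (which exists: `M_ext ≠ ∅`, `M_ext ⊆ doc`, anchor clause) it pairs negatively with
the future timelike `T = dA(e₀) = c⁻¹ dA(dΘ e₀)`: `g(T, dA dΘ V) = c⁻¹ g_{M,a}(e₀, V) = −c⁻¹ < 0`. The
hypothesis `InTelescope 𝓑` is idle. [cite: ONeill1983, Ch. 5, Lemma 5.32] -/
theorem kerrIdentificationFuture : ∀ (𝓑 : StationaryAFBlackHole.{0}) (A : 𝓑.AdaptedChart) (M a c r₀ : ℝ) (Θ : E4 → E4), InTelescope 𝓑 → IsKerrChartedWith 𝓑 A M a c r₀ Θ → ∀ u ∈ (Kerr.exterior M a : Set E4), ∀ h : Θ u ∈ A.domain, 𝓑.timeOrientation.IsFutureDirected (mfderiv 𝓘(ℝ, E4) (𝓡 4) A.toFun ⟨Θ u, h⟩ (fderiv ℝ Θ u (Kerr.timeVector M a u))) := by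
  intro 𝓑 A M a c r₀ Θ _ hK u hu h
  classical
  haveI : 𝓑.metric.HasLeviCivita := 𝓑.metric.toPseudoRiemannianMetric.hasLeviCivita
  obtain ⟨hsub, hc, -, hr₀, hΘs, -, hmaps, heqv, hiso, hanchor, -⟩ := hK
  set S : Set E4 := (Kerr.exterior M a : Set E4) with hS_def
  set R : Set E4 := (Kerr.region a r₀ : Set E4) with hR_def
  have hSo : IsOpen S := (Kerr.exterior M a).isOpen
  have hRo : IsOpen R := (Kerr.region a r₀).isOpen
  have hSR : S ⊆ R := fun x hx ↦ Kerr.region_mono a hr₀.le hx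
  have hM : 0 ≤ M := hsub.pos.le
  have hrad : ∀ x ∈ S, 0 < Kerr.radius a x := fun x hx ↦ Kerr.radius_pos_of_mem_region hx
  -- differentiability of `Θ` on the exterior
  have hΘS : ContDiffOn ℝ ∞ Θ S := hΘs.mono hSR
  have hΘd : ∀ x ∈ S, DifferentiableAt ℝ Θ x := fun x hx ↦
    (hΘS.contDiffAt (hSo.mem_nhds hx)).differentiableAt (by simp)
  -- a corestriction `φ : E4 → A.domain` of `Θ` on `S` (`Θ` maps the region into the chart domain)
  obtain ⟨φ, hφ⟩ : ∃ φ : E4 → A.domain, ∀ x ∈ S, (φ x : E4) = Θ x :=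
    ⟨fun x ↦ if hx : Θ x ∈ A.domain then ⟨Θ x, hx⟩ else ⟨Θ u, h⟩, fun x hx ↦ by
      dsimp only
      rw [dif_pos (show Θ x ∈ A.domain from hmaps (hSR hx))]⟩
  -- §1: chain rule and chart components of `g` along `A ∘ φ`
  have hmf : ∀ x ∈ S, ∀ v : E4, mfderiv 𝓘(ℝ, E4) (𝓡 4) (A.toFun ∘ φ) x v =
      mfderiv 𝓘(ℝ, E4) (𝓡 4) A.toFun (φ x) (fderiv ℝ Θ x v) := fun x hx v ↦
    mfderiv_adaptedChart_comp_apply A hSo hφ hx (hΘd x hx) v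
  have hcomp : ∀ x ∈ S, ∀ v w : E4,
      𝓑.toSpacetime.metricInCoords (A.toFun ∘ φ) x v w = Kerr.bilin M a x v w := by
    intro x hx v w
    rw [metricInCoords_adaptedChart_comp A hSo hφ hx (hΘd x hx)]
    exact hiso x hx v w
  -- §2: hypotheses of the orientation dichotomy
  have hΦs : ContMDiffOn 𝓘(ℝ, E4) (𝓡 4) ∞ (A.toFun ∘ φ) S := contMDiffOn_adaptedChart_comp A hSo hφ hΘS
  have hinj : ∀ y ∈ S, Function.Injective (mfderiv 𝓘(ℝ, E4) (𝓡 4) (A.toFun ∘ φ) y) := by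
    intro y hy v₁ v₂ hv
    rw [← sub_eq_zero]
    refine Kerr.bilin_nondegenerate M a (hrad y hy) (v₁ - v₂) fun w ↦ ?_
    rw [← hcomp y hy, Spacetime.metricInCoords_apply, map_sub, hv, sub_self, map_zero, zero_apply]
  have hpre : IsPreconnected S :=
    IsConnected.isPreconnected (Kerr.isConnected_region_holds a (Kerr.rPlus M a))
  have hY : ContinuousOn (Kerr.timeVector M a) S := fun x hx ↦
    (Kerr.contDiffAt_timeVector M a (hrad x hx) (n := 0)).continuousAt.continuousWithinAt
  have hneg : ∀ z ∈ S, 𝓑.toSpacetime.metricInCoords (A.toFun ∘ φ) z (Kerr.timeVector M a z)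
      (Kerr.timeVector M a z) < 0 := fun z hz ↦ by
    rw [hcomp z hz]
    exact Kerr.bilin_timeVector_timeVector_neg hM a (hrad z hz)
  -- §3: a base point `u₁` of the exterior charted into `M_ext`
  obtain ⟨m, hm⟩ := 𝓑.Mext_nonempty
  obtain ⟨w₁, hw₁⟩ := A.doc_subset_range (𝓑.Mext_subset_doc hm)
  have hw₁P : (w₁ : E4) ∈ Θ '' S := by
    rw [hanchor]
    refine ⟨w₁.2, ?_⟩
    rw [Subtype.coe_eta, hw₁]
    exact 𝓑.Mext_subset_doc hm
  obtain ⟨u₁, hu₁, hΘu₁⟩ := hw₁P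
  have hφu₁ : φ u₁ = w₁ := Subtype.ext (by rw [hφ u₁ hu₁]; exact hΘu₁)
  -- at the base point the pushed vector is future-directed
  have hbase : 𝓑.timeOrientation.IsFutureDirected
      (mfderiv 𝓘(ℝ, E4) (𝓡 4) (A.toFun ∘ φ) u₁ (Kerr.timeVector M a u₁)) := by
    -- `T = dA(e₀)` is future timelike at `A (φ u₁) = m ∈ M_ext`
    have hmem : A.toFun (φ u₁) ∈ 𝓑.Mext := by
      rw [hφu₁, hw₁]
      exact hm
    have hT := 𝓑.isStationaryKilling.isTimelike hmem
    rw [← A.mfderiv_toFun_basisVector (φ u₁)] at hT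
    -- `dΘ (e₀) = c e₀`, so `d(A ∘ φ)(c⁻¹ e₀) = dA(e₀) = T`
    have he₀ : fderiv ℝ Θ u₁ (E4.basisVector 0) = c • E4.basisVector 0 :=
      fderiv_apply_basisVector_zero_of_contDiffOn hRo (by simp) hΘs heqv (hSR hu₁)
    have hT'eq : mfderiv 𝓘(ℝ, E4) (𝓡 4) (A.toFun ∘ φ) u₁ (c⁻¹ • E4.basisVector 0) =
        mfderiv 𝓘(ℝ, E4) (𝓡 4) A.toFun (φ u₁) (E4.basisVector 0) := by
      rw [hmf u₁ hu₁, map_smul, he₀, smul_smul, inv_mul_cancel₀ hc.ne', one_smul]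
    -- `g(T, d(A ∘ φ) V) = c⁻¹ g_{M,a}(e₀, V) = -c⁻¹`
    have hval : 𝓑.metric.val ((A.toFun ∘ φ) u₁)
        (mfderiv 𝓘(ℝ, E4) (𝓡 4) A.toFun (φ u₁) (E4.basisVector 0))
        (mfderiv 𝓘(ℝ, E4) (𝓡 4) (A.toFun ∘ φ) u₁ (Kerr.timeVector M a u₁)) = -c⁻¹ := by
      have h1 := hcomp u₁ hu₁ (c⁻¹ • E4.basisVector 0) (Kerr.timeVector M a u₁)
      rw [Spacetime.metricInCoords_apply, hT'eq, map_smul, smul_apply,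
        Kerr.bilin_symm M a u₁ (E4.basisVector 0), Kerr.bilin_timeVector (hrad u₁ hu₁),
        smul_eq_mul] at h1
      refine h1.trans ?_
      simp [E4.basisVector]
    have hWc : 𝓑.metric.IsCausal (mfderiv 𝓘(ℝ, E4) (𝓡 4) (A.toFun ∘ φ) u₁ (Kerr.timeVector M a u₁)) :=
      (show 𝓑.metric.IsTimelike _ from hneg u₁ hu₁).isCausal
    exact 𝓑.timeOrientation.isFutureDirected_of_val_lt_zero hT.2 hT.1 hWc
      (hval.trans_lt (neg_lt_zero.2 (inv_pos.2 hc)))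
  -- §2: one orientation on the connected exterior
  rcases stub_futureDirected_dichotomy 𝓑.toSpacetime (A.toFun ∘ φ) S S (Kerr.timeVector M a) hSo hΦs
      hinj subset_rfl hpre hY hneg with hfut | hpast
  · -- transfer from `φ u` to the given `⟨Θ u, h⟩`
    have key : ∀ p : A.domain, p = φ u →
        𝓑.timeOrientation.IsFutureDirected
          (mfderiv 𝓘(ℝ, E4) (𝓡 4) A.toFun p (fderiv ℝ Θ u (Kerr.timeVector M a u))) := by
      rintro p rfl
      rw [← hmf u hu]
      exact hfut u hu
    exact key ⟨Θ u, h⟩ (Subtype.ext (hφ u hu).symm)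
  · have h2 := hpast u₁ hu₁
    have hmn : mfderiv 𝓘(ℝ, E4) (𝓡 4) (A.toFun ∘ φ) u₁ (-Kerr.timeVector M a u₁) =
        -(mfderiv 𝓘(ℝ, E4) (𝓡 4) (A.toFun ∘ φ) u₁ (Kerr.timeVector M a u₁)) :=
      (mfderiv 𝓘(ℝ, E4) (𝓡 4) (A.toFun ∘ φ) u₁).map_neg (Kerr.timeVector M a u₁)
    rw [hmn, TimeOrientation.isFutureDirected_neg_iff] at h2
    exact absurd h2 (𝓑.timeOrientation.not_isPastDirected_of_isFutureDirected hbase)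

end Summit.FinalStateConjecture.FinalStateConjecture.Theorems.SymplecticDualOfTheBomb

end
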